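import Summits.ABC.StewartYu.PadicG3SatFrame
import Summits.ABC.StewartYu.SatBasisReduced
import HarnessLib

/-!
# Cell abc-stewartyu, WP-L.P(odd) (crux r3 `PadicCoreOddRat`, stmt-ABC-20503): the saturated frame WITH THE INDEX IDENTITY `N = |det C|`
# (reshape of line `sat-odd`: the Siegel count over the skew family needs `#satFam ≥ N·∏(2sⱼ)`, i.e. `|det C| = N` — `SatBoxCount.card_satBox_ge`)

`Summits/ABC/StewartYu/PadicG3SatFrameD.lean` — cell `abc-stewartyu` (seat p2-g6, line lead of crux r3).  Two definitions + theorems; no named fact.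
WHY: `SatKit`/`RecordSupplyOddSatR` (`PadicG3SatFrame`) do not record `N = |det C|`; without it the B1 count of the record cannot be met by
degenerate saturation data (`C = 1`, `U = N·1`, `θ = α`: `#satFam = ∏(2sⱼ+1)` while `L0N ∝ 1/N`).  p1's `SatBasisReduced.exists_reduced_satFrame`
DOES deliver `(N : ℤ) = |C.det|`; this file threads it:

* `SatKitD n` — `SatKit n` plus the conjunct `(N : ℤ) = |C.det|`; `satKitD_all : ∀ n, SatKitD n` (from `exists_reduced_satFrame`);
  `satKit_of_satKitD`;
* `G3Setup.RecordSupplyOddSatRD C p n` — `RecordSupplyOddSatR` with the extra hypothesis `(F.N : ℤ) = |F.C.det|` (what the record proves);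
  `recordSupplyOddSatRD_of_R` (the old supply implies the new);
* `G3Setup.frameOddRatPos_of_recordSatRD : 1 ≤ n → p ≠ 2 → SatKitD n → RecordSupplyOddSatRD C p n → FrameOddRatPos C p n`
  (the proof of `frameOddRatPos_of_recordSatR` verbatim, threading the identity).

References: Yu. V. Nesterenko, LNM 1819 (2003) Prop 4.1, §3.5 (the count of 𝔏), §4.3, §5; K. Yu, Acta Math. 211 (2013) §1.1.
-/

noncomputable section

open NormedSpace Finset Polynomial
open scoped Matrix
open Literature.NumberTheory.Transcendental
open Literature.NumberTheory.Transcendental.CW77.Setup (Tau tauNorm)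
open Summit.ABC.StewartYu.GenThreeFrameSpecOdd (RecordOdd)
open Summit.ABC.StewartYu.GenThreeFrameSpecOddRat (FrameOddRatPos rootUnitsN hind_rootUnitsN)
open Summit.ABC.StewartYu.GenThreeFrameSpecTwoRat (FrameOutputReal)
open scoped Nat

namespace Summit.ABC.StewartYu

/-- **The lattice kit with the index identity**: `SatKit n` and `N = |det C|`. [cite: Nesterenko2003, §3.5 Prop 3.7, §4.3 Cor 4.5; shape only] -/
def SatKitD (n : ℕ) : Prop :=
  ∀ (α : Fin n → ℚ), (∀ j, 0 < α j) → (∀ μ : Fin n → ℤ, ∏ j, α j ^ μ j = 1 → μ = 0) →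
    ∃ (θ : Fin n → ℚ) (U C : Matrix (Fin n) (Fin n) ℤ) (N : ℕ),
      (∀ i, 0 < θ i) ∧ (∀ μ : Fin n → ℤ, ∏ i, θ i ^ μ i = 1 → μ = 0) ∧
      (∀ κ : Fin n → ℤ, (∃ γ : ℚ, ∏ i, θ i ^ κ i = γ ^ 2 ∨ ∏ i, θ i ^ κ i = -γ ^ 2) → ∀ i, (2 : ℤ) ∣ κ i) ∧
      0 < N ∧ (∀ i, θ i ^ N = ∏ j, α j ^ U i j) ∧ (∀ j, α j = ∏ i, θ i ^ C j i) ∧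
      U * C = (N : ℤ) • (1 : Matrix (Fin n) (Fin n) ℤ) ∧ C * U = (N : ℤ) • (1 : Matrix (Fin n) (Fin n) ℤ) ∧
      (N : ℝ) ≤ ∏ j, (2 * max 1 (Height.logHeight₁ (α j)) / Real.log 2) ∧
      (∀ j, ∑ i, |U i j| ≤ (n : ℤ) * N) ∧ (∀ j k, |C j k| ≤ ((n.factorial * N : ℕ) : ℤ)) ∧
      (∀ i, Height.logHeight₁ (θ i) ≤ ∑ j, max 1 (Height.logHeight₁ (α j))) ∧
      (N : ℤ) = |C.det|

/-- `SatKitD n → SatKit n`. [folklore] -/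
theorem satKit_of_satKitD {n : ℕ} (h : SatKitD n) : SatKit n := by
  intro α hα hind
  obtain ⟨θ, U, C, N, h1, h2, h3, h4, h5, h6, h7, h8, h9, h10, h11, h12, -⟩ := h α hα hind
  exact ⟨θ, U, C, N, h1, h2, h3, h4, h5, h6, h7, h8, h9, h10, h11, h12⟩

/-- **The lattice kit with the index identity holds at every rank** (p1's `SatBasisReduced.exists_reduced_satFrame`, which records
`N = |det C|`, weakened by `sizes_weaken`). [cite: Nesterenko2003, §3.5 and §4.3 Cor 4.5; Cassels1997, Ch. I §2.2] -/
theorem satKitD_all : ∀ n, SatKitD n := by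
  intro n α hα hind
  obtain ⟨θ, U, C, N, hpos, hθind, -, hkum, hNpos, hU, hC, hUC, hCU, hdet, hNle, -, hcol, hCle, hht, -⟩ :=
    SatBasisReduced.exists_reduced_satFrame α hα hind
  obtain ⟨hN', hC', hh'⟩ := SatBasisReduced.sizes_weaken (θ := θ) hNle hCle hht
  refine ⟨θ, U, C, N, hpos, hθind, hkum, hNpos, hU, hC, hUC, hCU, hN', hcol, fun j k => ?_, hh', hdet⟩
  push_cast
  exact hC' j k

namespace G3Setup

variable {p : ℕ} [Fact p.Prime]

/-- **What the record proves for one rank, INDEX-IDENTITY form**: as `RecordSupplyOddSatR`, with the extra hypothesis `N = |det C|`.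
[cite: Nesterenko2003, Prop 4.1, §5; shape only] -/
def RecordSupplyOddSatRD (C : ℕ → ℝ) (p n : ℕ) [Fact p.Prime] : Prop :=
  ∀ (S : G3Setup p) (F : S.SatData) (V : Fin S.n → ℝ) (Vmax W : ℝ), S.n = n →
    (∀ j, padicValRat p (F.αo j) = 0) → (∀ i, padicValRat p (S.α i) = 0) →
    (∀ j, Height.logHeight₁ (F.αo j) ≤ V j) → (∀ j, 1 ≤ V j) → (∀ j, V j ≤ Vmax) →
    (∀ j, Real.log (max 3 (|F.bo j| : ℝ)) ≤ W) → 1 ≤ W →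
    ¬ (padicValRat p (∏ j, F.αo j ^ F.bo j - 1) : ℝ) * Real.log p ≤
        C S.n * ((p : ℝ) / Real.log p) * (∏ j, V j) * (W + Real.log p + Real.log (2 * Vmax)) →
    (F.N : ℝ) ≤ ∏ j, (2 * V j / Real.log 2) →
    (∀ j, (F.Ucol j : ℤ) ≤ (S.n : ℤ) * F.N) → (∀ j k, |F.C j k| ≤ ((S.n.factorial * F.N : ℕ) : ℤ)) →
    (∀ i, Height.logHeight₁ (S.α i) ≤ ∑ j, V j) →
    ((F.N : ℤ) = |F.C.det|) →
    S.RecordSupplyAtSatR F C V Vmax W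

/-- The old supply implies the index-identity supply. [folklore] -/
theorem recordSupplyOddSatRD_of_R {C : ℕ → ℝ} {n : ℕ} (h : RecordSupplyOddSatR C p n) : RecordSupplyOddSatRD C p n :=
  fun S F V Vmax W hn h1 h2 h3 h4 h5 h6 h7 h8 h9 h10 h11 h12 _ => h S F V Vmax W hn h1 h2 h3 h4 h5 h6 h7 h8 h9 h10 h11 h12

/-- **THE KUMMER-FREE ODD-`p` FRAME FROM THE LATTICE KIT (with index identity) AND THE RECORD'S SUPPLY.**
[cite: Nesterenko2003, Prop 4.1, §3.5, §4.3, §5] -/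
theorem frameOddRatPos_of_recordSatRD {C : ℕ → ℝ} {n : ℕ} (hn : 1 ≤ n) (hp2 : p ≠ 2) (hkit : SatKitD n)
    (hrec : RecordSupplyOddSatRD C p n) : FrameOddRatPos C p n := by
  classical
  intro α b V Vmax W hpos hα hind hV hV1 hVmax hb hW hW1 hneg
  have hp3 : 3 ≤ p := G3FrameData.three_le_of_prime_ne_two hp2
  -- the reduced saturated basis
  obtain ⟨θ, U, Cm, Nn, hθpos, hθind, hθK, hNn, hU, hC, hUC, hCU, hNle, hUle, hCle, hθh, hdet⟩ := hkit α hpos hind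
  have hθne : ∀ i, θ i ≠ 0 := fun i => (hθpos i).ne'
  have hαne : ∀ j, α j ≠ 0 := fun j => (hα j).1
  -- `θ` are `p`-adic units: `N·ord_p θᵢ = Σⱼ Uᵢⱼ ord_p αⱼ = 0`
  have hθv : ∀ i, padicValRat p (θ i) = 0 := by
    intro i
    have h := SatCoords.natCast_mul_padicValRat_prod_zpow (q := p) α θ U Nn hαne hU (Pi.single i 1)
    have h1 : ∏ i', θ i' ^ (Pi.single i (1 : ℤ) : Fin n → ℤ) i' = θ i := by
      rw [Finset.prod_eq_single i (fun i' _ hi' => by rw [Pi.single_eq_of_ne hi', zpow_zero]) (fun h => absurd (mem_univ i) h),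
        Pi.single_eq_same, zpow_one]
    rw [h1] at h
    have h0 : ∑ j, (Pi.single i (1 : ℤ) ᵥ* U) j * padicValRat p (α j) = 0 :=
      sum_eq_zero fun j _ => by rw [(hα j).2, mul_zero]
    rw [h0] at h
    rcases mul_eq_zero.mp h with h2 | h2
    · exact absurd (by exact_mod_cast h2 : Nn = 0) hNn.ne'
    · exact h2
  -- the transported coefficients `b̃ = b ᵥ* C` and their pivot
  set bt : Fin n → ℤ := b ᵥ* Cm with hbt
  have hbtU : bt ᵥ* U = (Nn : ℤ) • b := by
    rw [hbt, Matrix.vecMul_vecMul, hCU, Matrix.vecMul_smul, Matrix.vecMul_one]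
  have hbt0 : bt ≠ 0 := by
    intro h0
    apply hb
    have h1 : (Nn : ℤ) • b = 0 := by rw [← hbtU, h0, Matrix.zero_vecMul]
    funext j
    have := congrFun h1 j
    simp only [Pi.smul_apply, smul_eq_mul, Pi.zero_apply, mul_eq_zero] at this
    rcases this with h2 | h2
    · exact absurd (by exact_mod_cast h2 : Nn = 0) hNn.ne'
    · exact h2
  obtain ⟨k₀, hbk₀, hbmin⟩ := G3FrameData.exists_pivot (p := p) bt hbt0
  -- the set-up on `θ` and its saturation datum
  set S : G3Setup p := G3Setup.ofData hp3 θ hθne hθv bt k₀ hbk₀ hbmin with hSdef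
  have hSn : S.n = n := rfl
  set F : S.SatData := SatData.mk α hpos hθpos U Cm Nn hNn hU hC hUC hCU b rfl with hFdef
  -- the negated bound, transported (`∏ θ^{b̃} = ∏ α^b`)
  have hnegS : ¬ (padicValRat p (∏ j, F.αo j ^ F.bo j - 1) : ℝ) * Real.log p ≤
      C S.n * ((p : ℝ) / Real.log p) * (∏ j, V j) * (W + Real.log p + Real.log (2 * Vmax)) := hneg
  -- the kit's size data in the record's form
  have hmaxV : ∀ j, max 1 (Height.logHeight₁ (α j)) ≤ V j := fun j => max_le (hV1 j) (hV j)
  have hNV : (F.N : ℝ) ≤ ∏ j, (2 * V j / Real.log 2) := by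
    refine hNle.trans (prod_le_prod (fun j _ => by positivity) fun j _ => ?_)
    have hl2 : 0 < Real.log 2 := Real.log_pos one_lt_two
    exact div_le_div_of_nonneg_right (by linarith [hmaxV j]) hl2.le
  have hUcol : ∀ j, (F.Ucol j : ℤ) ≤ (S.n : ℤ) * F.N := fun j => by rw [F.cast_Ucol]; exact hUle j
  have hθhV : ∀ i, Height.logHeight₁ (S.α i) ≤ ∑ j, V j := fun i => (hθh i).trans (sum_le_sum fun j _ => hmaxV j)
  obtain ⟨m, s, Lc, L₀, H, Sh, X₀, T₀, N, T, Nh, X', S₀, den₀, M₀, Xb, Amax, D₀, D, hT₀, hN00, hT00, hΛ, hΛm, hLc, hcount, hden₀, hR, hXb,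
    hAmax, hA, hpacks, hXfin, hSfin, hD₀, hD, hrecord⟩ :=
    hrec S F V Vmax W rfl (fun j => (hα j).2) hθv hV hV1 hVmax hW hW1 hnegS hNV hUcol hCle hθhV hdet
  -- twist data and the signed Kummer condition of `θ`
  obtain ⟨ζ, r, hζ, hζM, hζ1, hη⟩ := G3Setup.ofData_exists_zeta hp3 θ hθne hθv bt k₀ hbk₀ hbmin
  have hindS : ∀ T₁ : Finset (Fin S.n), T₁.Nonempty → ¬ IsSquare (∏ j ∈ T₁, S.α j) ∧ ¬ IsSquare (-∏ j ∈ T₁, S.α j) :=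
    fun T₁ hT₁ => G3FrameData.not_isSquare_prod_of_kummer S.α hθK T₁ hT₁
  -- START
  obtain ⟨𝔏, μb, pv, h𝔏, hμb, hstart⟩ := start_sat F m Lc (fun j => F.N * s j) L₀ (fun ℓ₀ => S.Rl H Sh 0 (ℓ₀, 0)) X₀ T₀ hT₀ hΛm
    (Icc (-(X₀ : ℤ)) X₀ ×ˢ tauSetR S.n S.j₀ T₀) rfl hcount den₀ hden₀ M₀ hR hXb hAmax hA
  obtain ⟨hK0, hH, hO, hKs⟩ := hpacks 𝔏 h𝔏
  have hRl0 : (fun i : ℕ × (Fin S.n → ℤ) => S.Rl H Sh 0 (i.1, 0)) = S.Rl H Sh 0 := by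
    funext i; unfold Rl; rfl
  rw [hRl0] at hstart
  have hstart' : S.LvInvSatI F (S.Rl H Sh 0) (S.unk L₀ 𝔏) (fun i => i.2 - μb) (fun _ => 1) pv (fun k => -(Lc k : ℤ) - μb k) (S.Lb Lc 0)
      (fun j => -((F.N * s j : ℕ) : ℤ) - (μb ᵥ* F.U) j) (S.Lb (fun j => F.N * s j) 0) ⌈((S.unk L₀ 𝔏).card : ℝ) * Amax⌉ m
      {x : ℤ | |x| ≤ (N 0 0 : ℤ)} (T 0 0) := by
    rw [hN00, hT00]; exact hstart
  have hlev0 := LvInvSatI.kchain (subset_refl _) hΛ (N 0) (T 0) 0 S.n (fun ν _ h1 => hK0 ν (by omega)) hstart'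
  rw [zero_add] at hlev0
  have hst0 : S.LevelStateSat F H Sh Lc (fun j => F.N * s j) (S.unk L₀ 𝔏) pv ⌈((S.unk L₀ 𝔏).card : ℝ) * Amax⌉ m 0 (N 0 S.n) (T 0 S.n) := by
    refine ⟨S.unk L₀ 𝔏, fun i => i.2 - μb, fun _ => 1, _, _, subset_refl _, ?_, hlev0⟩
    intro i _ i' _
    constructor
    · intro h
      funext j
      have hj := congrFun h j
      simp only [Pi.sub_apply] at hj
      omega
    · intro h
      simp only [h]
  -- the levels
  have hn1 : 1 ≤ S.n := hSn ▸ hn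
  have hfinal := levelsSat hn1 hΛ hΛm hζ hζM hζ1 r hη hindS N T Nh hH hO hKs hst0 Sh le_rfl
  -- the output at the real root point, `bo`-directions with the pivot of `b`
  obtain ⟨j₀, hbj₀, -⟩ := G3FrameData.exists_pivot (p := p) b hb
  obtain ⟨B, v, sgn, lo, vlo, hBU, hinj, hlast⟩ := hfinal
  have hlast' : S.LvInvSatI F (fun i => FeldmanBasis.feldR i.1 H) B v sgn pv lo (S.Lb Lc Sh) vlo (S.Lb (fun j => F.N * s j) Sh)
      ⌈((S.unk L₀ 𝔏).card : ℝ) * Amax⌉ m {x : ℤ | |x| ≤ (N Sh S.n : ℤ)} (T Sh S.n) :=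
    hlast.congr_R fun i _ t x => S.hasse_Rl_last H Sh i t x
  have hdeg : ∀ i ∈ B, i.1 ≤ L₀ := by
    intro i hi
    have := hBU hi
    unfold unk at this
    have := (mem_product.mp this).1
    rw [mem_range] at this
    omega
  have hout := hlast'.frameOutputSat hdeg hinj hXfin hSfin j₀
  refine ⟨j₀, D₀, S₀, X', D, rootUnitsN F.N F.αo F.hαo, hbj₀, hind_rootUnitsN F.N F.hN F.αo F.hαo hind, ?_, hrecord⟩
  exact frameOutputReal_mono hD₀ hD hout

end G3Setup

end Summit.ABC.StewartYu

end
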